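import Summits.HubbardSuperconductivity.HubbardSuperconductivity.Theorems.BalabanIRBirComplexStableXYRRotorWitnessNear
import Mathlib.Analysis.InnerProductSpace.Basic
import HarnessLib

/-!
# RP-free long-range order of the `(2+1)`-dimensional XY rotor on `(ℤ/L)² × ℤ/M`:
# II. From near pairs to all equal-time pairs (chaining)

Second file of the BC5 witness for `BirComplexStableXYR` (stmt-HubbardSuperconductivity-14845).
File I (`…RotorWitnessNear`) bounds `1 − ⟨cos(θ_{(πx,0)} − θ_{(πy,0)})⟩_K ≤ √(C/K)` for equal-time
pairs with `16‖x − y‖₂² < L²` (Garban–Spencer's estimator run through imaginary time). Here: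

* the elementary CHAINING inequality on the circle,
  `1 − cos(φ₀ − φ_k) ≤ k ∑_{j<k} (1 − cos(φ_j − φ_{j+1}))`
  (polygon inequality for the chord distance `|e^{iφ} − e^{iψ}|² = 2(1 − cos(φ − ψ))` and
  Cauchy–Schwarz), and its expectation form for the positive normalised functional `⟨·⟩_K`
  (`one_sub_expect_cosDiff_le_chain`);
* every pair of equal-time sites of `(ℤ/L)²`, `L ≥ 40`, is joined by `8` axis-parallel hops of
  length `< L/4` (centred lifts `ZMod.valMinAbs`, four hops per coordinate), whence the
  ALL-PAIRS bound `xyRotor_slice_twoPoint_ge_half`: for `K ≥ K₂`, `40 ≤ L ≤ M`,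
  `⟨cos(θ_{(a,0)} − θ_{(b,0)})⟩_K ≥ 1/2` for all `a, b ∈ (ℤ/L)²` — uniformly in `M ≥ L`, with no
  parity hypothesis and no reflection positivity.

## References
* C. Garban, T. Spencer, J. Math. Phys. 63 (2022) 093302, arXiv:2109.01617, Thm. 1.3 / Remark 1.
  [GarbanSpencer2022]
-/

noncomputable section

set_option linter.dupNamespace false -- summit = problem name (single-conjunct summit), D-0017

namespace Summit.HubbardSuperconductivity.HubbardSuperconductivity.Theorems

open MeasureTheory Finset
open scoped BigOperators ComplexConjugate
open Literature.Probability.LatticeModels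

/-! ### The Gibbs expectation is a positive normalised linear functional -/

section Expect

variable {V ι : Type*} [Fintype V] [Fintype ι] [MeasurableSpace Circle] [BorelSpace Circle]
  (G : BondSystem V ι)

/-- Additivity of the XY Gibbs expectation on continuous observables. [folklore] -/
theorem xyExpect_add (β : ℝ) (u : ι → Circle) {f g : (V → Circle) → ℝ} (hf : Continuous f)
    (hg : Continuous g) :
    G.expect β u (fun θ => f θ + g θ) = G.expect β u f + G.expect β u g := by
  unfold BondSystem.expect
  rw [← add_div]
  congr 1
  have hfi : Integrable (fun θ => f θ * G.weight β u θ) (torusHaar V) :=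
    integrable_torusHaar_of_continuous (hf.mul (G.continuous_weight β u))
  have hgi : Integrable (fun θ => g θ * G.weight β u θ) (torusHaar V) :=
    integrable_torusHaar_of_continuous (hg.mul (G.continuous_weight β u))
  rw [← integral_add hfi hgi]
  refine integral_congr_ae (ae_of_all _ fun θ => ?_)
  simp only [add_mul]

/-- Homogeneity of the XY Gibbs expectation. [folklore] -/
theorem xyExpect_const_mul (β : ℝ) (u : ι → Circle) (c : ℝ) (f : (V → Circle) → ℝ) :
    G.expect β u (fun θ => c * f θ) = c * G.expect β u f := by
  unfold BondSystem.expect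
  rw [← mul_div_assoc, ← integral_const_mul]
  congr 1
  refine integral_congr_ae (ae_of_all _ fun θ => ?_)
  simp only [mul_assoc]

/-- The XY Gibbs expectation of a constant. [folklore] -/
theorem xyExpect_const (β : ℝ) (u : ι → Circle) (c : ℝ) : G.expect β u (fun _ => c) = c := by
  have h := xyExpect_const_mul G β u c (fun _ => 1)
  simp only [mul_one, BondSystem.expect_one] at h
  exact h

/-- Monotonicity of the XY Gibbs expectation on continuous observables. [folklore] -/
theorem xyExpect_mono (β : ℝ) (u : ι → Circle) {f g : (V → Circle) → ℝ} (hf : Continuous f)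
    (hg : Continuous g) (hfg : ∀ θ, f θ ≤ g θ) : G.expect β u f ≤ G.expect β u g := by
  unfold BondSystem.expect
  refine div_le_div_of_nonneg_right ?_ (G.partitionFn_pos β u).le
  refine integral_mono (integrable_torusHaar_of_continuous (hf.mul (G.continuous_weight β u)))
    (integrable_torusHaar_of_continuous (hg.mul (G.continuous_weight β u))) fun θ => ?_
  exact mul_le_mul_of_nonneg_right (hfg θ) (G.weight_pos β u θ).le

/-- Finite additivity of the XY Gibbs expectation on continuous observables. [folklore] -/
theorem xyExpect_sum (β : ℝ) (u : ι → Circle) {S : Type*} (s : Finset S)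
    (f : S → (V → Circle) → ℝ) (hf : ∀ j, Continuous (f j)) :
    G.expect β u (fun θ => ∑ j ∈ s, f j θ) = ∑ j ∈ s, G.expect β u (f j) := by
  classical
  induction s using Finset.induction_on with
  | empty => simp only [Finset.sum_empty]; exact xyExpect_const G β u 0
  | insert a s ha ih =>
    simp only [Finset.sum_insert ha]
    rw [← ih]
    exact xyExpect_add G β u (hf a) (continuous_finsetSum _ fun j _ => hf j)

end Expect

/-! ### Chaining on the circle -/

/-- The chord distance on the unit circle: `‖b − a‖² = 2(1 − Re(ā b))` for `a, b ∈ U(1)`.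
[folklore] -/
theorem circle_norm_sub_sq (a b : Circle) :
    ‖(b : ℂ) - (a : ℂ)‖ ^ 2 = 2 * (1 - (conj (a : ℂ) * (b : ℂ)).re) := by
  rw [@norm_sub_sq_real ℂ, Complex.inner, Circle.norm_coe, Circle.norm_coe]
  have : ((a : ℂ) * conj (b : ℂ)).re = (conj (a : ℂ) * (b : ℂ)).re := by
    rw [← Complex.conj_re ((a : ℂ) * conj (b : ℂ)), map_mul, Complex.conj_conj, mul_comm]
  rw [this]; ring

/-- **Chaining inequality on the circle.** For unit complex numbers `z₀, …, z_k`,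
`1 − Re(z̄₀ z_k) ≤ k ∑_{j<k} (1 − Re(z̄_j z_{j+1}))` (polygon inequality for the chord distance
and Cauchy–Schwarz). [folklore] -/
theorem one_sub_re_le_chain (z : ℕ → Circle) (k : ℕ) :
    1 - (conj (z 0 : ℂ) * (z k : ℂ)).re ≤ k * ∑ j ∈ Finset.range k, (1 - (conj (z j : ℂ) * (z (j + 1) : ℂ)).re) := by
  have hpoly := dist_le_range_sum_dist (fun j => (z j : ℂ)) k
  simp only [dist_eq_norm] at hpoly
  have h0 : 0 ≤ ∑ j ∈ Finset.range k, ‖(z j : ℂ) - (z (j + 1) : ℂ)‖ :=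
    Finset.sum_nonneg fun j _ => norm_nonneg _
  have hsq : ‖(z 0 : ℂ) - (z k : ℂ)‖ ^ 2 ≤ (∑ j ∈ Finset.range k, ‖(z j : ℂ) - (z (j + 1) : ℂ)‖) ^ 2 :=
    pow_le_pow_left₀ (norm_nonneg _) hpoly 2
  have hcs : (∑ j ∈ Finset.range k, ‖(z j : ℂ) - (z (j + 1) : ℂ)‖) ^ 2 ≤
      k * ∑ j ∈ Finset.range k, ‖(z j : ℂ) - (z (j + 1) : ℂ)‖ ^ 2 := by
    have h := Finset.sum_mul_sq_le_sq_mul_sq (Finset.range k)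
      (fun j => ‖(z j : ℂ) - (z (j + 1) : ℂ)‖) (fun _ => (1 : ℝ))
    simp only [mul_one, one_pow, Finset.sum_const, Finset.card_range, nsmul_eq_mul] at h
    linarith
  have e0 : ‖(z 0 : ℂ) - (z k : ℂ)‖ ^ 2 = 2 * (1 - (conj (z 0 : ℂ) * (z k : ℂ)).re) := by
    rw [norm_sub_rev]; exact circle_norm_sub_sq (z 0) (z k)
  have ej : ∀ j, ‖(z j : ℂ) - (z (j + 1) : ℂ)‖ ^ 2 = 2 * (1 - (conj (z j : ℂ) * (z (j + 1) : ℂ)).re) :=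
    fun j => by rw [norm_sub_rev]; exact circle_norm_sub_sq (z j) (z (j + 1))
  simp only [ej] at hcs
  rw [e0] at hsq
  rw [← Finset.mul_sum] at hcs
  nlinarith [hsq, hcs]

/-- **Chaining for the two-point function.** Along any sequence of sites `p₀, …, p_k`,
`1 − ⟨cos(θ_{p₀} − θ_{p_k})⟩ ≤ k ∑_{j<k} (1 − ⟨cos(θ_{p_j} − θ_{p_{j+1}})⟩)` for the XY Gibbs
expectation on any bond system (pointwise chaining, linearity and monotonicity). [folklore] -/
theorem one_sub_expect_cosDiff_le_chain {V ι : Type*} [Fintype V] [Fintype ι]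
    [MeasurableSpace Circle] [BorelSpace Circle] (G : BondSystem V ι) (β : ℝ) (u : ι → Circle)
    (p : ℕ → V) (k : ℕ) :
    1 - G.expect β u (cosDiff (p 0) (p k)) ≤
      k * ∑ j ∈ Finset.range k, (1 - G.expect β u (cosDiff (p j) (p (j + 1)))) := by
  have hpt : ∀ θ : V → Circle, 1 - cosDiff (p 0) (p k) θ ≤
      k * ∑ j ∈ Finset.range k, (1 - cosDiff (p j) (p (j + 1)) θ) :=
    fun θ => one_sub_re_le_chain (fun j => θ (p j)) k
  have hc1 : Continuous fun θ : V → Circle => 1 - cosDiff (p 0) (p k) θ :=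
    continuous_const.sub (continuous_cosDiff _ _)
  have hcj : ∀ j, Continuous fun θ : V → Circle => 1 - cosDiff (p j) (p (j + 1)) θ :=
    fun j => continuous_const.sub (continuous_cosDiff _ _)
  have hc2 : Continuous fun θ : V → Circle =>
      (k : ℝ) * ∑ j ∈ Finset.range k, (1 - cosDiff (p j) (p (j + 1)) θ) :=
    continuous_const.mul (continuous_finsetSum _ fun j _ => hcj j)
  have hmono := xyExpect_mono G β u hc1 hc2 hpt
  have lhs : G.expect β u (fun θ => 1 - cosDiff (p 0) (p k) θ) = 1 - G.expect β u (cosDiff (p 0) (p k)) := by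
    have h := xyExpect_add G β u (f := fun _ => (1 : ℝ)) (g := fun θ => (-1) * cosDiff (p 0) (p k) θ)
      continuous_const (continuous_const.mul (continuous_cosDiff _ _))
    rw [xyExpect_const, xyExpect_const_mul] at h
    have e : (fun θ : V → Circle => 1 - cosDiff (p 0) (p k) θ) =
        fun θ => (1 : ℝ) + (-1) * cosDiff (p 0) (p k) θ := funext fun θ => by ring
    rw [e, h]; ring
  have rhs : G.expect β u (fun θ => (k : ℝ) * ∑ j ∈ Finset.range k, (1 - cosDiff (p j) (p (j + 1)) θ)) =
      k * ∑ j ∈ Finset.range k, (1 - G.expect β u (cosDiff (p j) (p (j + 1)))) := by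
    rw [xyExpect_const_mul, xyExpect_sum G β u (Finset.range k) _ hcj]
    congr 1
    refine Finset.sum_congr rfl fun j _ => ?_
    have h := xyExpect_add G β u (f := fun _ => (1 : ℝ)) (g := fun θ => (-1) * cosDiff (p j) (p (j + 1)) θ)
      continuous_const (continuous_const.mul (continuous_cosDiff _ _))
    rw [xyExpect_const, xyExpect_const_mul] at h
    have e : (fun θ : V → Circle => 1 - cosDiff (p j) (p (j + 1)) θ) =
        fun θ => (1 : ℝ) + (-1) * cosDiff (p j) (p (j + 1)) θ := funext fun θ => by ring
    rw [e, h]; ring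
  rw [← lhs, ← rhs]
  exact hmono

/-! ### Every equal-time pair is eight short hops apart -/

/-- **Four short integer hops.** Every integer `v` with `2|v| ≤ L`, `L ≥ 40`, is the sum of four
integers `q, q, q, q + r` (`q = ⌊v/4⌋`, `0 ≤ r < 4`) each of absolute value `< L/4`
(indeed `4|h| < L`). [folklore] -/
theorem int_four_hops {L : ℕ} (hL : 40 ≤ L) (v : ℤ) (hv : 2 * |v| ≤ (L : ℤ)) :
    4 * |v / 4| < (L : ℤ) ∧ 4 * |v / 4 + v % 4| < (L : ℤ) ∧ v / 4 + v / 4 + v / 4 + (v / 4 + v % 4) = v := by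
  have h4 : (4 : ℤ) ≠ 0 := by norm_num
  have hdiv : 4 * (v / 4) + v % 4 = v := Int.mul_ediv_add_emod v 4
  have hr0 : 0 ≤ v % 4 := Int.emod_nonneg v h4
  have hr4 : v % 4 < 4 := Int.emod_lt_of_pos v (by norm_num)
  have hL' : (40 : ℤ) ≤ (L : ℤ) := by exact_mod_cast hL
  have hq : 4 * |v / 4| ≤ |v| + 3 := by
    rw [show (4 : ℤ) * |v / 4| = |4 * (v / 4)| by rw [abs_mul]; norm_num]
    have : 4 * (v / 4) = v - v % 4 := by linarith
    rw [this]
    calc |v - v % 4| ≤ |v| + |v % 4| := abs_sub _ _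
      _ ≤ |v| + 3 := by rw [abs_of_nonneg hr0]; linarith
  refine ⟨by linarith, ?_, by linarith⟩
  calc 4 * |v / 4 + v % 4| ≤ 4 * (|v / 4| + |v % 4|) := by
        have := abs_add_le (v / 4) (v % 4); linarith
    _ = 4 * |v / 4| + 4 * |v % 4| := by ring
    _ ≤ (|v| + 3) + 4 * 3 := by rw [abs_of_nonneg hr0]; linarith
    _ < (L : ℤ) := by linarith

/-- The near-pair hypothesis of file I for an axis-parallel hop `y = x + h eᵢ` with `4|h| < L`:
`16‖x − y‖₂² < L²`. [folklore] -/
theorem hop_near {L : ℕ} (x : Site 2) (i : Fin 2) (h : ℤ) (hh : 4 * |h| < (L : ℤ)) :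
    16 * ∑ j, ((x j : ℝ) - ((x + Pi.single i h : Site 2) j : ℝ)) ^ 2 < (L : ℝ) ^ 2 := by
  have hsum : ∑ j, ((x j : ℝ) - ((x + Pi.single i h : Site 2) j : ℝ)) ^ 2 = (h : ℝ) ^ 2 := by
    rw [Fin.sum_univ_two]
    fin_cases i <;> simp [Pi.add_apply]
  rw [hsum]
  have h1 : (4 : ℝ) * |(h : ℝ)| < (L : ℝ) := by
    have : ((4 * |h| : ℤ) : ℝ) < ((L : ℤ) : ℝ) := by exact_mod_cast hh
    simpa using this
  have h2 : 0 ≤ (4 : ℝ) * |(h : ℝ)| := by positivity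
  have h3 : ((4 : ℝ) * |(h : ℝ)|) ^ 2 < (L : ℝ) ^ 2 := by
    exact pow_lt_pow_left₀ h1 h2 (by norm_num)
  have h4 : ((4 : ℝ) * |(h : ℝ)|) ^ 2 = 16 * (h : ℝ) ^ 2 := by
    rw [mul_pow, sq_abs]; norm_num
  linarith

variable [MeasurableSpace Circle] [BorelSpace Circle]

/-- **One hop.** Under the near-pair bound of file I with constant `ε`, an axis-parallel hop of
length `h`, `4|h| < L`, from the lift `x ∈ ℤ²` costs at most `ε`:
`1 − ⟨cos(θ_{(πx,0)} − θ_{(π(x + h eᵢ),0)})⟩ ≤ ε`. [folklore] -/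
theorem hop_bound {K ε : ℝ} {L M : ℕ} [NeZero L] [NeZero M]
    (hnear : ∀ x y : Site 2, 16 * ∑ i, ((x i : ℝ) - (y i : ℝ)) ^ 2 < (L : ℝ) ^ 2 →
      1 - (JCurrent.bondSystem 2 L M).expect K 1
          (cosDiff ((Torus.proj L x, 0) : JCurrent.SpaceTimeSite 2 L M) ((Torus.proj L y, 0))) ≤ ε)
    (x : Site 2) (i : Fin 2) (h : ℤ) (hh : 4 * |h| < (L : ℤ)) :
    1 - (JCurrent.bondSystem 2 L M).expect K 1
        (cosDiff ((Torus.proj L x, 0) : JCurrent.SpaceTimeSite 2 L M)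
          ((Torus.proj L (x + Pi.single i h : Site 2), 0))) ≤ ε := by
  have h1 := hop_near (L := L) x i h hh
  -- generalise the hop endpoint first (direct application makes the unifier time out)
  generalize (x + Pi.single i h : Site 2) = y at h1 ⊢
  exact hnear x y h1

/-- **All equal-time pairs, RP-free.** There is `K₂ > 0` such that for all `K ≥ K₂`, all
`L, M` with `40 ≤ L ≤ M` and all `a, b ∈ (ℤ/L)²`, the XY model
`exp(K ∑_{(s,μ)} cos(θ_{s+e_μ} − θ_s)) dθ` on the space-time torus `(ℤ/L)² × ℤ/M` satisfies
`⟨cos(θ_{(a,0)} − θ_{(b,0)})⟩_K ≥ 1/2`: equal-time two-point long-range order at EVERY distance,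
uniformly in the imaginary-time extent `M ≥ L`, without parity or reflection-positivity
hypotheses (Garban–Spencer's near-pair bound of file I chained along eight hops of length `< L/4`).
[cite: GarbanSpencer2022, Theorem 1.3 with Remark 1] -/
theorem xyRotor_slice_twoPoint_ge_half :
    ∃ K₂ : ℝ, 0 < K₂ ∧ ∀ K : ℝ, K₂ ≤ K → ∀ (L M : ℕ) [NeZero L] [NeZero M], 40 ≤ L → L ≤ M →
      ∀ a b : TorusSite 2 L,
        (1 / 2 : ℝ) ≤ (JCurrent.bondSystem 2 L M).expect K 1
          (cosDiff ((a, 0) : JCurrent.SpaceTimeSite 2 L M) ((b, 0))) := by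
  obtain ⟨C, K₁, hC, hK₁, hnear⟩ := xyRotor_near_twoPoint
  -- `64 √(C/K) ≤ 1/2` as soon as `K ≥ 2^14 C`
  refine ⟨max K₁ (2 ^ 14 * C), lt_max_of_lt_left hK₁, ?_⟩
  intro K hK L M _ _ hL hLM a b
  have hKK₁ : K₁ ≤ K := le_trans (le_max_left _ _) hK
  have hKC : 2 ^ 14 * C ≤ K := le_trans (le_max_right _ _) hK
  have hK0 : 0 < K := lt_of_lt_of_le hK₁ hKK₁
  set ε : ℝ := Real.sqrt (C / K) with hε
  have hε64 : 64 * ε ≤ 1 / 2 := by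
    have h1 : C / K ≤ (1 / 128 : ℝ) ^ 2 := by
      rw [div_le_iff₀ hK0]; nlinarith
    have h2 : ε ≤ 1 / 128 := by
      rw [hε]
      calc Real.sqrt (C / K) ≤ Real.sqrt ((1 / 128 : ℝ) ^ 2) := Real.sqrt_le_sqrt h1
        _ = 1 / 128 := Real.sqrt_sq (by norm_num)
    linarith
  set G := JCurrent.bondSystem 2 L M with hG
  have hnear' : ∀ x y : Site 2, 16 * ∑ i, ((x i : ℝ) - (y i : ℝ)) ^ 2 < (L : ℝ) ^ 2 →
      1 - G.expect K 1 (cosDiff ((Torus.proj L x, 0) : JCurrent.SpaceTimeSite 2 L M)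
        ((Torus.proj L y, 0))) ≤ ε := fun x y hxy => hnear K hKK₁ L M hLM x y hxy
  -- centred lifts of the displacement, split into four hops per coordinate
  set v : Fin 2 → ℤ := fun i => (b i - a i).valMinAbs with hv
  have hvle : ∀ i, 2 * |v i| ≤ (L : ℤ) := by
    intro i
    have h := ZMod.natAbs_valMinAbs_le (b i - a i)
    have h' : ((v i).natAbs : ℤ) ≤ ((L / 2 : ℕ) : ℤ) := by exact_mod_cast h
    rw [Int.natCast_natAbs] at h'
    have h2 : (((L / 2 : ℕ)) : ℤ) * 2 ≤ (L : ℤ) := by exact_mod_cast Nat.div_mul_le_self L 2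
    linarith
  obtain ⟨h0a, h0b, h0s⟩ := int_four_hops hL (v 0) (hvle 0)
  obtain ⟨h1a, h1b, h1s⟩ := int_four_hops hL (v 1) (hvle 1)
  -- the hop lengths and directions
  set len : ℕ → ℤ := fun j =>
    if j = 3 then v 0 / 4 + v 0 % 4 else if j < 4 then v 0 / 4
    else if j = 7 then v 1 / 4 + v 1 % 4 else v 1 / 4 with hlen
  set dir : ℕ → Fin 2 := fun j => if j < 4 then 0 else 1 with hdir
  have hlen_lt : ∀ j, 4 * |len j| < (L : ℤ) := by
    intro j
    simp only [hlen]
    split_ifs <;> assumption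
  -- the integer path `P j = A + ∑_{m<j} len m • e_{dir m}` from a lift `A` of `a`
  set A : Site 2 := fun i => ((a i).val : ℤ) with hA
  have hAa : Torus.proj L A = a := by
    funext i; simp [hA, Torus.proj_apply]
  set P : ℕ → Site 2 := fun j => A + ∑ m ∈ Finset.range j, Pi.single (dir m) (len m) with hP
  have hP0 : P 0 = A := by simp [hP]
  have hPsucc : ∀ j, P (j + 1) = P j + Pi.single (dir j) (len j) := by
    intro j; simp only [hP, Finset.sum_range_succ, add_assoc]
  have hP8 : Torus.proj L (P 8) = b := by
    have hsum : ∑ m ∈ Finset.range 8, (Pi.single (dir m) (len m) : Site 2) = fun i => v i := by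
      funext i
      simp only [Finset.sum_apply, Finset.sum_range_succ, Finset.sum_range_zero, hdir, hlen]
      fin_cases i
      · simp
        linarith [h0s]
      · simp
        linarith [h1s]
    rw [hP]
    simp only [hsum]
    funext i
    simp only [Torus.proj_apply, Pi.add_apply, Int.cast_add, hA, hv, ZMod.coe_valMinAbs,
      ZMod.intCast_cast, ZMod.cast_id', id_eq, ZMod.natCast_val]
    ring
  -- chaining along the projected path
  set p : ℕ → JCurrent.SpaceTimeSite 2 L M := fun j => (Torus.proj L (P j), 0) with hp
  have hchain := one_sub_expect_cosDiff_le_chain G K 1 p 8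
  have hp0 : p 0 = ((a, 0) : JCurrent.SpaceTimeSite 2 L M) := by simp only [hp, hP0, hAa]
  have hp8 : p 8 = ((b, 0) : JCurrent.SpaceTimeSite 2 L M) := by simp only [hp, hP8]
  rw [hp0, hp8] at hchain
  have hhops : ∀ j ∈ Finset.range 8, 1 - G.expect K 1 (cosDiff (p j) (p (j + 1))) ≤ ε := by
    intro j _
    simp only [hp, hPsucc]
    exact hop_bound hnear' (P j) (dir j) (len j) (hlen_lt j)
  have hsum : ∑ j ∈ Finset.range 8, (1 - G.expect K 1 (cosDiff (p j) (p (j + 1)))) ≤ 8 * ε := by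
    calc ∑ j ∈ Finset.range 8, (1 - G.expect K 1 (cosDiff (p j) (p (j + 1))))
        ≤ ∑ _j ∈ Finset.range 8, ε := Finset.sum_le_sum hhops
      _ = 8 * ε := by simp
  have : 1 - G.expect K 1 (cosDiff ((a, 0) : JCurrent.SpaceTimeSite 2 L M) ((b, 0))) ≤ 64 * ε := by
    calc 1 - G.expect K 1 (cosDiff ((a, 0) : JCurrent.SpaceTimeSite 2 L M) ((b, 0)))
        ≤ (8 : ℕ) * ∑ j ∈ Finset.range 8, (1 - G.expect K 1 (cosDiff (p j) (p (j + 1)))) := hchain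
      _ ≤ (8 : ℕ) * (8 * ε) := mul_le_mul_of_nonneg_left hsum (by positivity)
      _ = 64 * ε := by push_cast; ring
  linarith

end Summit.HubbardSuperconductivity.HubbardSuperconductivity.Theorems

end
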